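import Summits.CriticalPhenomena.PercolationContinuityZ3.Theorems.Transplant.Bcc111SKDefs
import Summits.CriticalPhenomena.PercolationContinuityZ3.Theorems.Transplant.Slab111SKBits
import HarnessLib

/-!
# The bcc (111)-films at small thickness, II: SOUNDNESS OF THE BITBOARD PRIMITIVES with elevator bonds (`nbhE`, `reachE`, `pathOKE`)

builds on p205010 (kernel theorem, internal audit signed; external expert review pending) — NOT used in this file.  Lane `prim-bschramm`, seat
`prim-bschramm-p2` (gen 49; class C1b; memo `HOME/bschramm/P2-LATTICES.md` §160); helper file (`--supports stmt-CriticalPhenomena-4575 --as helper`).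
The twin of «Slab111SKBits» §2–§3 for the eight-offset adjacency `adjE` of «Bcc111SKDefs» (three up-steps `+110, +99, +91` and the elevator `+300`):
* §1 `AdjRelE` (the adjacency as a proposition), `adjE_iff`, symmetry;
* §2 `testBit_nbhE` (a set bit of the neighbourhood has an `AdjRelE`-neighbour in the argument) and its converse `testBit_nbhE_of` (for the exit
  mask), walks `IsWalkInE`, **`reachE_sound`**;
* §3 **`pathOKE_sound`** (a re-validated index list is an `AdjRelE`-chain without repetitions inside the region).
The mask dictionary (`testBit_bitOf`, `testBit_sdiff`, `testBit_maskBelow`, `testBit_orFold`, `testBit_maskOfList`, …) is «Slab111SKBits» §1, reused.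
[cite: DuminilCopinSidoraviciusTassion2016, §2.3 (proof of Fact 2)] [cite: ConwaySloane1999, Ch. 4 §7.1]
-/

namespace Summit.CriticalPhenomena.PercolationContinuityZ3.Theorems.Transplant

namespace Bcc111.SK

open Slab111.SK (dL dA dB bitOf sdiff lowStep lowIdx maskOfList endsOK maskBelow orFold rd rdMask colSlots testBit_bitOf testBit_sdiff)

/-! ## §1 The adjacency relation -/

/-- Index adjacency of the bcc (111)-film as a proposition (three up-steps and the elevator, both directions). [cite: ConwaySloane1999, Ch. 4 §7.1] -/
def AdjRelE (i j : ℕ) : Prop :=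
  j = i + 110 ∨ j = i + 99 ∨ j = i + 91 ∨ j = i + 300 ∨ i = j + 110 ∨ i = j + 99 ∨ i = j + 91 ∨ i = j + 300

/-- `adjE` decides `AdjRelE`. [folklore] -/
theorem adjE_iff {i j : ℕ} : adjE i j = true ↔ AdjRelE i j := by
  simp only [adjE, AdjRelE, Bool.or_eq_true, beq_iff_eq, or_assoc]

/-- `AdjRelE` is symmetric. [folklore] -/
theorem AdjRelE.symm {i j : ℕ} (h : AdjRelE i j) : AdjRelE j i := by
  unfold AdjRelE at *; omega

/-! ## §2 Neighbourhoods and reachability -/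

/-- **A bit of the neighbourhood mask has an adjacent bit in the argument** (and lies in the universe). [folklore] -/
theorem testBit_nbhE {u m j : ℕ} (h : (nbhE u m).testBit j = true) : u.testBit j = true ∧ ∃ i, m.testBit i = true ∧ AdjRelE i j := by
  unfold nbhE at h
  rw [Nat.testBit_land, Bool.and_eq_true] at h
  refine ⟨h.2, ?_⟩
  have h1 := h.1
  simp only [Nat.testBit_lor, Bool.or_eq_true, Nat.testBit_shiftLeft, Nat.testBit_shiftRight, Bool.and_eq_true,
    decide_eq_true_eq] at h1
  unfold AdjRelE
  rcases h1 with ((((((⟨h1, h2⟩ | ⟨h1, h2⟩) | ⟨h1, h2⟩) | ⟨h1, h2⟩) | h2) | h2) | h2) | h2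
  · exact ⟨j - 110, h2, by omega⟩
  · exact ⟨j - 99, h2, by omega⟩
  · exact ⟨j - 91, h2, by omega⟩
  · exact ⟨j - 300, h2, by omega⟩
  · exact ⟨110 + j, h2, by omega⟩
  · exact ⟨99 + j, h2, by omega⟩
  · exact ⟨91 + j, h2, by omega⟩
  · exact ⟨300 + j, h2, by omega⟩

/-- **Conversely, an `AdjRelE`-neighbour in the universe of a bit of the argument is a bit of the neighbourhood mask.** [folklore] -/
theorem testBit_nbhE_of {u m i j : ℕ} (hu : u.testBit j = true) (hi : m.testBit i = true) (h : AdjRelE i j) : (nbhE u m).testBit j = true := by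
  unfold nbhE
  rw [Nat.testBit_land, hu, Bool.and_true]
  simp only [Nat.testBit_lor, Bool.or_eq_true, Nat.testBit_shiftLeft, Nat.testBit_shiftRight, Bool.and_eq_true, decide_eq_true_eq]
  unfold AdjRelE at h
  rcases h with h | h | h | h | h | h | h | h
  · left; left; left; left; left; left; left; exact ⟨by omega, by rw [show j - 110 = i by omega]; exact hi⟩
  · left; left; left; left; left; left; right; exact ⟨by omega, by rw [show j - 99 = i by omega]; exact hi⟩
  · left; left; left; left; left; right; exact ⟨by omega, by rw [show j - 91 = i by omega]; exact hi⟩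
  · left; left; left; left; right; exact ⟨by omega, by rw [show j - 300 = i by omega]; exact hi⟩
  · left; left; left; right; rw [show 110 + j = i by omega]; exact hi
  · left; left; right; rw [show 99 + j = i by omega]; exact hi
  · left; right; rw [show 91 + j = i by omega]; exact hi
  · right; rw [show 300 + j = i by omega]; exact hi

/-- **An index walk inside a region**: an `AdjRelE`-chain `s :: l` all of whose members are bits of `R`. [folklore] -/
def IsWalkInE (R : ℕ) (s : ℕ) (l : List ℕ) : Prop := (s :: l).IsChain AdjRelE ∧ ∀ x ∈ s :: l, R.testBit x = true

/-- The end of the walk `s :: l`. [folklore] -/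
def walkEndE (s : ℕ) (l : List ℕ) : ℕ := (s :: l).getLast (List.cons_ne_nil _ _)

/-- Extending a walk by an adjacent region vertex. [folklore] -/
theorem IsWalkInE.snoc {R s : ℕ} {l : List ℕ} (h : IsWalkInE R s l) {j : ℕ} (hadj : AdjRelE (walkEndE s l) j) (hj : R.testBit j = true) :
    IsWalkInE R s (l ++ [j]) ∧ walkEndE s (l ++ [j]) = j := by
  refine ⟨⟨?_, ?_⟩, ?_⟩
  · have : s :: (l ++ [j]) = (s :: l) ++ [j] := rfl
    rw [this, List.isChain_append]
    refine ⟨h.1, List.IsChain.singleton _, fun x hx y hy => ?_⟩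
    rw [List.getLast?_eq_some_getLast (List.cons_ne_nil _ _), Option.mem_def, Option.some.injEq] at hx
    simp only [List.head?_cons, Option.mem_def, Option.some.injEq] at hy
    subst hx hy; exact hadj
  · intro x hx
    simp only [List.mem_cons, List.mem_append, List.not_mem_nil, or_false] at hx
    rcases hx with rfl | hx | rfl
    · exact h.2 _ (by simp)
    · exact h.2 _ (List.mem_cons_of_mem _ hx)
    · exact hj
  · show ((s :: l) ++ [j]).getLast _ = j
    simp

/-- **SOUNDNESS OF `reachGoE`**: if every bit of `cur` is the end of a walk from a bit of `src` inside `R`, the same holds for the result. [folklore] -/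
theorem reachGoE_sound (u R src : ℕ) :
    ∀ (f cur : ℕ), (∀ j, cur.testBit j = true → ∃ s l, src.testBit s = true ∧ IsWalkInE R s l ∧ walkEndE s l = j) →
      ∀ j, (reachGoE u R f cur).testBit j = true → ∃ s l, src.testBit s = true ∧ IsWalkInE R s l ∧ walkEndE s l = j := by
  intro f
  induction f with
  | zero => intro cur hcur j hj; exact hcur j hj
  | succ f ih =>
    intro cur hcur j hj
    simp only [reachGoE] at hj
    have hnxt : ∀ j, ((cur ||| nbhE u cur) &&& R).testBit j = true → ∃ s l, src.testBit s = true ∧ IsWalkInE R s l ∧ walkEndE s l = j := by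
      intro j hj
      rw [Nat.testBit_land, Bool.and_eq_true, Nat.testBit_lor, Bool.or_eq_true] at hj
      rcases hj with ⟨hj | hj, hR⟩
      · exact hcur j hj
      · obtain ⟨-, i, hi, hadj⟩ := testBit_nbhE hj
        obtain ⟨s, l, hs, hw, he⟩ := hcur i hi
        subst he
        exact ⟨s, l ++ [j], hs, (hw.snoc hadj hR).1, (hw.snoc hadj hR).2⟩
    cases hb : ((cur ||| nbhE u cur) &&& R == cur)
    · rw [hb] at hj; exact ih _ hnxt j hj
    · rw [hb] at hj; exact hcur j hj

/-- **SOUNDNESS OF `reachE`**: a reachable bit is the end of an index walk inside the region from a bit of `src ∩ region`. [folklore] -/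
theorem reachE_sound {u R src j : ℕ} (h : (reachE u R src).testBit j = true) :
    ∃ s l, src.testBit s = true ∧ R.testBit s = true ∧ IsWalkInE R s l ∧ walkEndE s l = j := by
  unfold reachE at h
  have base : ∀ j, (src &&& R).testBit j = true → ∃ s l, (src &&& R).testBit s = true ∧ IsWalkInE R s l ∧ walkEndE s l = j := by
    intro j hj
    refine ⟨j, [], hj, ⟨List.IsChain.singleton _, fun x hx => ?_⟩, rfl⟩
    simp only [List.mem_cons, List.not_mem_nil, or_false] at hx
    subst hx
    rw [Nat.testBit_land, Bool.and_eq_true] at hj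
    exact hj.2
  obtain ⟨s, l, hs, hw, he⟩ := reachGoE_sound u R (src &&& R) 200 _ base j h
  rw [Nat.testBit_land, Bool.and_eq_true] at hs
  exact ⟨s, l, hs.1, hs.2, hw, he⟩

/-! ## §3 Re-validated paths -/

/-- **SOUNDNESS OF `pathOKE`**: an `AdjRelE`-chain without repetitions, inside `reg`, off `seen`. [folklore] -/
theorem pathOKE_sound (reg : ℕ) : ∀ (l : List ℕ) (seen : ℕ), pathOKE reg l seen = true →
    l.IsChain AdjRelE ∧ l.Nodup ∧ ∀ x ∈ l, reg.testBit x = true ∧ seen.testBit x = false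
  | [], _, _ => ⟨List.IsChain.nil, List.nodup_nil, fun _ h => nomatch h⟩
  | [i], seen, h => by
    simp only [pathOKE, Bool.and_eq_true, Bool.not_eq_true'] at h
    exact ⟨List.IsChain.singleton _, List.nodup_singleton _, fun x hx => by simp only [List.mem_singleton] at hx; subst hx; exact h⟩
  | i :: j :: rest, seen, h => by
    simp only [pathOKE, Bool.and_eq_true, Bool.not_eq_true'] at h
    obtain ⟨⟨⟨hi, hsi⟩, hij⟩, hrest⟩ := h
    obtain ⟨hch, hnd, hmem⟩ := pathOKE_sound reg (j :: rest) (seen ||| bitOf i) hrest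
    refine ⟨List.isChain_cons_cons.2 ⟨adjE_iff.1 hij, hch⟩, List.nodup_cons.2 ⟨fun hmi => ?_, hnd⟩, fun x hx => ?_⟩
    · have := (hmem i hmi).2
      rw [Nat.testBit_lor, testBit_bitOf] at this
      simp at this
    · rcases List.mem_cons.1 hx with rfl | hx
      · exact ⟨hi, hsi⟩
      · have := hmem x hx
        rw [Nat.testBit_lor, Bool.or_eq_false_iff] at this
        exact ⟨this.1, this.2.1⟩

end Bcc111.SK

end Summit.CriticalPhenomena.PercolationContinuityZ3.Theorems.Transplant
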